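/-
  Summits/AtomisticToContinuum/Crystallization/Theorems/OverbindingBudgetAffineFarFirstShellCompanions.lean

  residual stmt-AtomisticToContinuum-31280 · slot Z `FarAggregatePricing 12 (1/25) (1/2000) (1/(2·10⁷))` · leaf LAB₁′ `ShelteredShellLabelling'`
  (leaf list v14′, critic row 890): the GEOMETRIC INPUTS of DRIFT₁ — part A1 of the split of g56 file A (482 l > 400) requested by
  critic row 890; part A2 `…FarFirstShellDrift` (DRIFT₁ itself) imports this file.  decomp-a2c lens-4, generations 56–57.
  Imports ONLY the tree file `…OverbindingBudgetAffineFarLabelDrift`.  0 sorry · 0 axiom · no instance · no notation · no option.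
-/
import Summits.AtomisticToContinuum.Crystallization.Theorems.OverbindingBudgetAffineFarLabelDrift

/-! # First-shell companions: the two geometric inputs of DRIFT₁

Content (both PROVED, byte-identical with §1–§2 of the g56 file `…FarFirstShellDrift` of record sha16 25d6986152819196, which was split
into this file A1 and the DRIFT₁ file A2 to respect the 400-line bound on Theorems files):
* §1 TETRAHEDRAL COMPANIONS (`exists_tetrahedral_companions`, 18 cases on Hales's layer shells): every vector `X` of a layer shell
  `layerShell σ σ'` has two shell vectors `W₁, W₂` with `⟪X,W₁⟫ = ⟪X,W₂⟫ = ⟪W₁,W₂⟫ = 2` — every contact edge of a close-packed stacking lies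
  in a regular tetrahedron of pairwise touching balls (hexagon edge + the hole above/below it; the three upper holes; the three lower holes);
  with the Gram form `inner_frameCombo` of the frame `u₁ = (2,0,0)`, `u₂ = (1,√3,0)`, `𝗁e₃`.
* §2 OPERATOR BOUND FROM A UNIT TETRAHEDRAL FRAME (`norm_map_le_of_unit_frame`, coordinate-free): three unit vectors with pairwise
  inner products `1/2` are a basis of `ℝ³` (Gram matrix `½(I + J)`, linear independence by taking inner products, `span = ⊤` by dimension
  count) with `‖w‖² = ½Σcᵢ² + ½(Σcᵢ)²`, so `Σ|cᵢ| ≤ 3‖w‖` and `‖A fᵢ‖ ≤ b ⇒ ‖A w‖ ≤ 3b‖w‖`.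
USE: A2 `…FarFirstShellDrift` (§3 `shell_fit_compare₁` / `norm_map_sub_le_of_adjacent₁`, §4 ★ DRIFT₁ `labelDriftBound₁_holds`).
-/

namespace Summit.AtomisticToContinuum.Crystallization.Theorems.OverbindingBudgetAffineFarSmoothSplit

open scoped BigOperators Classical RealInnerProductSpace
open Literature.MathematicalPhysics.StatisticalMechanics
open Literature.Geometry.DiscreteGeometry (layerSpacing layerSpacing_sq layerSpacing_pos layerShell hexagonSet holeTriple
  mem_layerShell_iff hexagonSet_subset_layerShell mem_holeTriple_iff mem_holeTriple_one_iff frameW_eq norm_sq_fin3 sqrt_three_sq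
  inner_frameU_frameU inner_frameV_frameV inner_frameU_frameV inner_frameV_frameU inner_frameU_frameE inner_frameE_frameU
  inner_frameV_frameE inner_frameE_frameV inner_frameE_frameE inner_frameW_frameU inner_frameU_frameW inner_frameW_frameV
  inner_frameV_frameW inner_frameW_frameW inner_frameW_frameE inner_frameE_frameW)

/-! ## §1  Tetrahedral companions in the layer shells (PROVED, 18 cases) -/

/-- Gram form of the frame `u₁ = (2,0,0)`, `u₂ = (1,√3,0)`, `𝗁e₃`: the inner product of two combinations. [folklore; this file] -/
theorem inner_frameCombo {x z : EuclideanSpace ℝ (Fin 3)} {a b d a' b' d' : ℝ}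
    (hx : x = a • triangularVec₁ (2 : ℝ) + b • triangularVec₂ (2 : ℝ) + d • layerNormal layerSpacing)
    (hz : z = a' • triangularVec₁ (2 : ℝ) + b' • triangularVec₂ (2 : ℝ) + d' • layerNormal layerSpacing) :
    ⟪x, z⟫ = 4 * a * a' + 2 * a * b' + 2 * b * a' + 4 * b * b' + 8 / 3 * d * d' := by
  rw [hx, hz]
  simp only [inner_add_left, inner_add_right, real_inner_smul_left, real_inner_smul_right, inner_frameU_frameU,
    inner_frameU_frameV, inner_frameV_frameU, inner_frameV_frameV, inner_frameU_frameE, inner_frameE_frameU, inner_frameV_frameE,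
    inner_frameE_frameV, inner_frameE_frameE]
  ring

/-- **TETRAHEDRAL COMPANIONS (PROVED).** Every vector `X` of a layer shell `layerShell σ σ'` (`σ, σ' = ±1`; Hales's cuboctahedral /
anticuboctahedral tangent arrangements at in-layer spacing `2`) has two shell vectors `W₁, W₂` with `⟪X, W₁⟫ = ⟪X, W₂⟫ = ⟪W₁, W₂⟫ = 2`:
`{0, X, W₁, W₂}` is a regular tetrahedron of edge `2` (a hexagon edge and the hole of type `σ` above it; the three upper holes; the three
lower holes). [HalesDSP2012 §1.3; this file] -/
theorem exists_tetrahedral_companions {σ σ' : ℝ} (hσ : σ = 1 ∨ σ = -1) (hσ' : σ' = 1 ∨ σ' = -1)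
    {X : EuclideanSpace ℝ (Fin 3)} (hX : X ∈ layerShell σ σ') :
    ∃ W₁ ∈ layerShell σ σ', ∃ W₂ ∈ layerShell σ σ',
      ⟪X, W₁⟫ = (2 : ℝ) ∧ ⟪X, W₂⟫ = (2 : ℝ) ∧ ⟪W₁, W₂⟫ = (2 : ℝ) := by
  have hσ2 : σ * σ = 1 := by rcases hσ with rfl | rfl <;> norm_num
  have hσ'2 : σ' * σ' = 1 := by rcases hσ' with rfl | rfl <;> norm_num
  -- membership of the twelve shell vectors
  have hexmem : ∀ Y ∈ hexagonSet, Y ∈ layerShell σ σ' := fun Y hY => hexagonSet_subset_layerShell _ _ hY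
  have upmem : ∀ t ∈ holeTriple σ, t + layerNormal layerSpacing ∈ layerShell σ σ' := fun t ht =>
    mem_layerShell_iff.2 (Or.inr (Or.inl (by rwa [add_sub_cancel_right])))
  have dnmem : ∀ t ∈ holeTriple σ', t - layerNormal layerSpacing ∈ layerShell σ σ' := fun t ht =>
    mem_layerShell_iff.2 (Or.inr (Or.inr (by rwa [sub_add_cancel])))
  have t1 : ∀ τ : ℝ, τ • barlowOffset (2 : ℝ) ∈ holeTriple τ := fun τ => Set.mem_insert _ _
  have t2 : ∀ τ : ℝ, τ • (barlowOffset (2 : ℝ) - triangularVec₁ 2) ∈ holeTriple τ := fun τ =>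
    Set.mem_insert_of_mem _ (Set.mem_insert _ _)
  have t3 : ∀ τ : ℝ, τ • (barlowOffset (2 : ℝ) - triangularVec₂ 2) ∈ holeTriple τ := fun τ =>
    Set.mem_insert_of_mem _ (Set.mem_insert_of_mem _ rfl)
  have h1 : triangularVec₁ (2 : ℝ) ∈ hexagonSet := by simp [hexagonSet]
  have h2 : -triangularVec₁ (2 : ℝ) ∈ hexagonSet := by simp [hexagonSet]
  have h3 : triangularVec₂ (2 : ℝ) ∈ hexagonSet := by simp [hexagonSet]
  have h4 : -triangularVec₂ (2 : ℝ) ∈ hexagonSet := by simp [hexagonSet]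
  have h5 : triangularVec₁ (2 : ℝ) - triangularVec₂ 2 ∈ hexagonSet := by simp [hexagonSet]
  have h6 : triangularVec₂ (2 : ℝ) - triangularVec₁ 2 ∈ hexagonSet := by simp [hexagonSet]
  -- frame coordinates `(a, b, d)` of the twelve shell vectors (`w = (u₁ + u₂)/3`)
  have c1 : triangularVec₁ (2 : ℝ) =
      (1 : ℝ) • triangularVec₁ (2 : ℝ) + (0 : ℝ) • triangularVec₂ (2 : ℝ) + (0 : ℝ) • layerNormal layerSpacing := by module
  have c2 : -triangularVec₁ (2 : ℝ) =
      (-1 : ℝ) • triangularVec₁ (2 : ℝ) + (0 : ℝ) • triangularVec₂ (2 : ℝ) + (0 : ℝ) • layerNormal layerSpacing := by module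
  have c3 : triangularVec₂ (2 : ℝ) =
      (0 : ℝ) • triangularVec₁ (2 : ℝ) + (1 : ℝ) • triangularVec₂ (2 : ℝ) + (0 : ℝ) • layerNormal layerSpacing := by module
  have c4 : -triangularVec₂ (2 : ℝ) =
      (0 : ℝ) • triangularVec₁ (2 : ℝ) + (-1 : ℝ) • triangularVec₂ (2 : ℝ) + (0 : ℝ) • layerNormal layerSpacing := by module
  have c5 : triangularVec₁ (2 : ℝ) - triangularVec₂ 2 =
      (1 : ℝ) • triangularVec₁ (2 : ℝ) + (-1 : ℝ) • triangularVec₂ (2 : ℝ) + (0 : ℝ) • layerNormal layerSpacing := by module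
  have c6 : triangularVec₂ (2 : ℝ) - triangularVec₁ 2 =
      (-1 : ℝ) • triangularVec₁ (2 : ℝ) + (1 : ℝ) • triangularVec₂ (2 : ℝ) + (0 : ℝ) • layerNormal layerSpacing := by module
  have u1 : ∀ τ : ℝ, τ • barlowOffset (2 : ℝ) + layerNormal layerSpacing =
      (τ / 3) • triangularVec₁ (2 : ℝ) + (τ / 3) • triangularVec₂ (2 : ℝ) + (1 : ℝ) • layerNormal layerSpacing := by
    intro τ; rw [frameW_eq]; module
  have u2 : ∀ τ : ℝ, τ • (barlowOffset (2 : ℝ) - triangularVec₁ 2) + layerNormal layerSpacing =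
      (-(2 * τ) / 3) • triangularVec₁ (2 : ℝ) + (τ / 3) • triangularVec₂ (2 : ℝ) + (1 : ℝ) • layerNormal layerSpacing := by
    intro τ; rw [frameW_eq]; module
  have u3 : ∀ τ : ℝ, τ • (barlowOffset (2 : ℝ) - triangularVec₂ 2) + layerNormal layerSpacing =
      (τ / 3) • triangularVec₁ (2 : ℝ) + (-(2 * τ) / 3) • triangularVec₂ (2 : ℝ) + (1 : ℝ) • layerNormal layerSpacing := by
    intro τ; rw [frameW_eq]; module
  have d1 : ∀ τ : ℝ, τ • barlowOffset (2 : ℝ) - layerNormal layerSpacing =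
      (τ / 3) • triangularVec₁ (2 : ℝ) + (τ / 3) • triangularVec₂ (2 : ℝ) + (-1 : ℝ) • layerNormal layerSpacing := by
    intro τ; rw [frameW_eq]; module
  have d2 : ∀ τ : ℝ, τ • (barlowOffset (2 : ℝ) - triangularVec₁ 2) - layerNormal layerSpacing =
      (-(2 * τ) / 3) • triangularVec₁ (2 : ℝ) + (τ / 3) • triangularVec₂ (2 : ℝ) + (-1 : ℝ) • layerNormal layerSpacing := by
    intro τ; rw [frameW_eq]; module
  have d3 : ∀ τ : ℝ, τ • (barlowOffset (2 : ℝ) - triangularVec₂ 2) - layerNormal layerSpacing =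
      (τ / 3) • triangularVec₁ (2 : ℝ) + (-(2 * τ) / 3) • triangularVec₂ (2 : ℝ) + (-1 : ℝ) • layerNormal layerSpacing := by
    intro τ; rw [frameW_eq]; module
  rw [mem_layerShell_iff] at hX
  rcases hX with hH | hU | hD
  · -- `X` in the hexagon: companions = the adjacent hexagon vector whose triangle with `X` carries the hole of type `σ`, and that hole
    simp only [hexagonSet, Set.mem_insert_iff, Set.mem_singleton_iff] at hH
    rcases hσ with rfl | rfl
    · rcases hH with rfl | rfl | rfl | rfl | rfl | rfl
      · exact ⟨_, hexmem _ h3, _, upmem _ (t1 1), by rw [inner_frameCombo c1 c3]; norm_num,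
          by rw [inner_frameCombo c1 (u1 1)]; norm_num, by rw [inner_frameCombo c3 (u1 1)]; norm_num⟩
      · exact ⟨_, hexmem _ h6, _, upmem _ (t2 1), by rw [inner_frameCombo c2 c6]; norm_num,
          by rw [inner_frameCombo c2 (u2 1)]; norm_num, by rw [inner_frameCombo c6 (u2 1)]; norm_num⟩
      · exact ⟨_, hexmem _ h1, _, upmem _ (t1 1), by rw [inner_frameCombo c3 c1]; norm_num,
          by rw [inner_frameCombo c3 (u1 1)]; norm_num, by rw [inner_frameCombo c1 (u1 1)]; norm_num⟩
      · exact ⟨_, hexmem _ h5, _, upmem _ (t3 1), by rw [inner_frameCombo c4 c5]; norm_num,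
          by rw [inner_frameCombo c4 (u3 1)]; norm_num, by rw [inner_frameCombo c5 (u3 1)]; norm_num⟩
      · exact ⟨_, hexmem _ h4, _, upmem _ (t3 1), by rw [inner_frameCombo c5 c4]; norm_num,
          by rw [inner_frameCombo c5 (u3 1)]; norm_num, by rw [inner_frameCombo c4 (u3 1)]; norm_num⟩
      · exact ⟨_, hexmem _ h2, _, upmem _ (t2 1), by rw [inner_frameCombo c6 c2]; norm_num,
          by rw [inner_frameCombo c6 (u2 1)]; norm_num, by rw [inner_frameCombo c2 (u2 1)]; norm_num⟩
    · rcases hH with rfl | rfl | rfl | rfl | rfl | rfl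
      · exact ⟨_, hexmem _ h5, _, upmem _ (t2 (-1)), by rw [inner_frameCombo c1 c5]; norm_num,
          by rw [inner_frameCombo c1 (u2 (-1))]; norm_num, by rw [inner_frameCombo c5 (u2 (-1))]; norm_num⟩
      · exact ⟨_, hexmem _ h4, _, upmem _ (t1 (-1)), by rw [inner_frameCombo c2 c4]; norm_num,
          by rw [inner_frameCombo c2 (u1 (-1))]; norm_num, by rw [inner_frameCombo c4 (u1 (-1))]; norm_num⟩
      · exact ⟨_, hexmem _ h6, _, upmem _ (t3 (-1)), by rw [inner_frameCombo c3 c6]; norm_num,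
          by rw [inner_frameCombo c3 (u3 (-1))]; norm_num, by rw [inner_frameCombo c6 (u3 (-1))]; norm_num⟩
      · exact ⟨_, hexmem _ h2, _, upmem _ (t1 (-1)), by rw [inner_frameCombo c4 c2]; norm_num,
          by rw [inner_frameCombo c4 (u1 (-1))]; norm_num, by rw [inner_frameCombo c2 (u1 (-1))]; norm_num⟩
      · exact ⟨_, hexmem _ h1, _, upmem _ (t2 (-1)), by rw [inner_frameCombo c5 c1]; norm_num,
          by rw [inner_frameCombo c5 (u2 (-1))]; norm_num, by rw [inner_frameCombo c1 (u2 (-1))]; norm_num⟩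
      · exact ⟨_, hexmem _ h3, _, upmem _ (t3 (-1)), by rw [inner_frameCombo c6 c3]; norm_num,
          by rw [inner_frameCombo c6 (u3 (-1))]; norm_num, by rw [inner_frameCombo c3 (u3 (-1))]; norm_num⟩
  · -- `X` an upper hole: companions = the two other upper holes
    obtain ⟨t, ht, hXt⟩ := mem_holeTriple_iff.1 hU
    have hX : X = σ • t + layerNormal layerSpacing := by rw [← hXt, sub_add_cancel]
    subst hX
    rcases mem_holeTriple_one_iff.1 ht with rfl | rfl | rfl
    · exact ⟨_, upmem _ (t2 σ), _, upmem _ (t3 σ), by rw [inner_frameCombo (u1 σ) (u2 σ)]; linear_combination (-2 / 3 : ℝ) * hσ2,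
        by rw [inner_frameCombo (u1 σ) (u3 σ)]; linear_combination (-2 / 3 : ℝ) * hσ2,
        by rw [inner_frameCombo (u2 σ) (u3 σ)]; linear_combination (-2 / 3 : ℝ) * hσ2⟩
    · exact ⟨_, upmem _ (t1 σ), _, upmem _ (t3 σ), by rw [inner_frameCombo (u2 σ) (u1 σ)]; linear_combination (-2 / 3 : ℝ) * hσ2,
        by rw [inner_frameCombo (u2 σ) (u3 σ)]; linear_combination (-2 / 3 : ℝ) * hσ2,
        by rw [inner_frameCombo (u1 σ) (u3 σ)]; linear_combination (-2 / 3 : ℝ) * hσ2⟩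
    · exact ⟨_, upmem _ (t1 σ), _, upmem _ (t2 σ), by rw [inner_frameCombo (u3 σ) (u1 σ)]; linear_combination (-2 / 3 : ℝ) * hσ2,
        by rw [inner_frameCombo (u3 σ) (u2 σ)]; linear_combination (-2 / 3 : ℝ) * hσ2,
        by rw [inner_frameCombo (u1 σ) (u2 σ)]; linear_combination (-2 / 3 : ℝ) * hσ2⟩
  · -- `X` a lower hole: companions = the two other lower holes
    obtain ⟨t, ht, hXt⟩ := mem_holeTriple_iff.1 hD
    have hX : X = σ' • t - layerNormal layerSpacing := by rw [← hXt, add_sub_cancel_right]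
    subst hX
    rcases mem_holeTriple_one_iff.1 ht with rfl | rfl | rfl
    · exact ⟨_, dnmem _ (t2 σ'), _, dnmem _ (t3 σ'), by rw [inner_frameCombo (d1 σ') (d2 σ')]; linear_combination (-2 / 3 : ℝ) * hσ'2,
        by rw [inner_frameCombo (d1 σ') (d3 σ')]; linear_combination (-2 / 3 : ℝ) * hσ'2,
        by rw [inner_frameCombo (d2 σ') (d3 σ')]; linear_combination (-2 / 3 : ℝ) * hσ'2⟩
    · exact ⟨_, dnmem _ (t1 σ'), _, dnmem _ (t3 σ'), by rw [inner_frameCombo (d2 σ') (d1 σ')]; linear_combination (-2 / 3 : ℝ) * hσ'2,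
        by rw [inner_frameCombo (d2 σ') (d3 σ')]; linear_combination (-2 / 3 : ℝ) * hσ'2,
        by rw [inner_frameCombo (d1 σ') (d3 σ')]; linear_combination (-2 / 3 : ℝ) * hσ'2⟩
    · exact ⟨_, dnmem _ (t1 σ'), _, dnmem _ (t2 σ'), by rw [inner_frameCombo (d3 σ') (d1 σ')]; linear_combination (-2 / 3 : ℝ) * hσ'2,
        by rw [inner_frameCombo (d3 σ') (d2 σ')]; linear_combination (-2 / 3 : ℝ) * hσ'2,
        by rw [inner_frameCombo (d1 σ') (d2 σ')]; linear_combination (-2 / 3 : ℝ) * hσ'2⟩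

/-! ## §2  An operator bound from a unit tetrahedral frame (PROVED, coordinate-free) -/

/-- **OPERATOR BOUND FROM A UNIT TETRAHEDRAL FRAME (PROVED).** Three unit vectors of `ℝ³` with pairwise inner products `1/2` (three
edges of a regular unit tetrahedron at a vertex) span `ℝ³` with coefficients `Σ|cᵢ| ≤ 3‖w‖`; hence a linear map with `‖A fᵢ‖ ≤ b` has
`‖A w‖ ≤ 3 b ‖w‖`. [this file] -/
theorem norm_map_le_of_unit_frame (A : EuclideanSpace ℝ (Fin 3) →ₗ[ℝ] EuclideanSpace ℝ (Fin 3))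
    {f₁ f₂ f₃ : EuclideanSpace ℝ (Fin 3)} (h₁ : ‖f₁‖ = 1) (h₂ : ‖f₂‖ = 1) (h₃ : ‖f₃‖ = 1)
    (h₁₂ : ⟪f₁, f₂⟫ = (1 / 2 : ℝ)) (h₁₃ : ⟪f₁, f₃⟫ = (1 / 2 : ℝ)) (h₂₃ : ⟪f₂, f₃⟫ = (1 / 2 : ℝ))
    {b : ℝ} (hb₁ : ‖A f₁‖ ≤ b) (hb₂ : ‖A f₂‖ ≤ b) (hb₃ : ‖A f₃‖ ≤ b) (w : EuclideanSpace ℝ (Fin 3)) :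
    ‖A w‖ ≤ 3 * b * ‖w‖ := by
  have hb : 0 ≤ b := (norm_nonneg _).trans hb₁
  have s₁ : ⟪f₁, f₁⟫ = (1 : ℝ) := by rw [real_inner_self_eq_norm_sq, h₁]; norm_num
  have s₂ : ⟪f₂, f₂⟫ = (1 : ℝ) := by rw [real_inner_self_eq_norm_sq, h₂]; norm_num
  have s₃ : ⟪f₃, f₃⟫ = (1 : ℝ) := by rw [real_inner_self_eq_norm_sq, h₃]; norm_num
  have h₂₁ : ⟪f₂, f₁⟫ = (1 / 2 : ℝ) := by rw [real_inner_comm]; exact h₁₂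
  have h₃₁ : ⟪f₃, f₁⟫ = (1 / 2 : ℝ) := by rw [real_inner_comm]; exact h₁₃
  have h₃₂ : ⟪f₃, f₂⟫ = (1 / 2 : ℝ) := by rw [real_inner_comm]; exact h₂₃
  -- the frame is linearly independent (take inner products with `f₁, f₂, f₃`)
  set f : Fin 3 → EuclideanSpace ℝ (Fin 3) := ![f₁, f₂, f₃] with hf
  have hli : LinearIndependent ℝ f := by
    rw [Fintype.linearIndependent_iff]
    intro g hg
    simp only [hf, Fin.sum_univ_three, Matrix.cons_val_zero, Matrix.cons_val_one, Matrix.head_cons, Matrix.cons_val_two,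
      Matrix.tail_cons] at hg
    have e1 := congrArg (fun z => ⟪f₁, z⟫) hg
    have e2 := congrArg (fun z => ⟪f₂, z⟫) hg
    have e3 := congrArg (fun z => ⟪f₃, z⟫) hg
    simp only [inner_add_right, real_inner_smul_right, inner_zero_right, s₁, s₂, s₃, h₁₂, h₁₃, h₂₃, h₂₁, h₃₁, h₃₂] at e1 e2 e3
    have g0 : g 0 = 0 := by linarith
    have g1 : g 1 = 0 := by linarith
    have g2 : g 2 = 0 := by linarith
    intro i
    fin_cases i
    · exact g0
    · exact g1
    · exact g2
  -- hence a spanning set (dimension count), and `w` has coordinates `c`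
  have hspan : Submodule.span ℝ (Set.range f) = ⊤ := hli.span_eq_top_of_card_eq_finrank' (by simp)
  have hw : w ∈ Submodule.span ℝ (Set.range f) := by rw [hspan]; exact Submodule.mem_top
  obtain ⟨c, hc⟩ := (Submodule.mem_span_range_iff_exists_fun ℝ).1 hw
  simp only [hf, Fin.sum_univ_three, Matrix.cons_val_zero, Matrix.cons_val_one, Matrix.head_cons, Matrix.cons_val_two,
    Matrix.tail_cons] at hc
  -- `‖w‖² = ½Σcᵢ² + ½(Σcᵢ)²`
  have hn : ‖w‖ ^ 2 = 1 / 2 * (c 0 ^ 2 + c 1 ^ 2 + c 2 ^ 2) + 1 / 2 * (c 0 + c 1 + c 2) ^ 2 := by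
    rw [← hc, ← real_inner_self_eq_norm_sq]
    simp only [inner_add_left, inner_add_right, real_inner_smul_left, real_inner_smul_right, s₁, s₂, s₃, h₁₂, h₁₃, h₂₃, h₂₁,
      h₃₁, h₃₂]
    ring
  have hAw : ‖A w‖ ≤ b * (|c 0| + |c 1| + |c 2|) := by
    rw [← hc]
    simp only [map_add, map_smul]
    calc ‖c 0 • A f₁ + c 1 • A f₂ + c 2 • A f₃‖ ≤ ‖c 0 • A f₁‖ + ‖c 1 • A f₂‖ + ‖c 2 • A f₃‖ := norm_add₃_le
      _ = |c 0| * ‖A f₁‖ + |c 1| * ‖A f₂‖ + |c 2| * ‖A f₃‖ := by simp only [norm_smul, Real.norm_eq_abs]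
      _ ≤ |c 0| * b + |c 1| * b + |c 2| * b := by gcongr
      _ = b * (|c 0| + |c 1| + |c 2|) := by ring
  have hS : |c 0| + |c 1| + |c 2| ≤ 3 * ‖w‖ := by
    have h2 : (|c 0| + |c 1| + |c 2|) ^ 2 ≤ (3 * ‖w‖) ^ 2 := by
      nlinarith [sq_abs (c 0), sq_abs (c 1), sq_abs (c 2), abs_nonneg (c 0), abs_nonneg (c 1), abs_nonneg (c 2),
        sq_nonneg (|c 0| - |c 1|), sq_nonneg (|c 1| - |c 2|), sq_nonneg (|c 0| - |c 2|), sq_nonneg (c 0 + c 1 + c 2),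
        norm_nonneg w]
    exact (abs_le_of_sq_le_sq' h2 (by positivity)).2
  calc ‖A w‖ ≤ b * (|c 0| + |c 1| + |c 2|) := hAw
    _ ≤ b * (3 * ‖w‖) := mul_le_mul_of_nonneg_left hS hb
    _ = 3 * b * ‖w‖ := by ring

end Summit.AtomisticToContinuum.Crystallization.Theorems.OverbindingBudgetAffineFarSmoothSplit
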